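import Summits.Ventures.Crystal3D.Theorems.StickyWulffConstantWulffUpperBoundTruncatedOctahedra

/-!
# The truncated octahedra `TO_n` of `D₃`, II: the hexagon count of the `(1,1,0)`-boundary and the
stub `stub_cluster` of the crux `WulffUpperBound` (stmt-Ventures-19147)

HONEST FRAMING. Part of the venture `Summits/Ventures/Crystal3D` (cell `crystal3d-full`, crux
seat `crystal3d-wulff-p1`), line `WulffPeel` of the route crux `WulffUpperBound`
(route `StickyWulffConstant`). CONSTRUCTION SIDE ONLY, pure `ℤ³` combinatorics [folklore],
continuing `StickyWulffConstantWulffUpperBoundTruncatedOctahedra.lean` (Part I: `≥ 16 n³` points,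
symmetry transport, line-convexity). Here, with `n = k + 1` and
`TO_n = {v ∈ fccOctahedronInt (3k+3) | |vᵢ| ≤ 2k+2}`:
* `card_boundary_le`: the points `v ∈ TO_n` with `v + (1,1,0) ∉ TO_n` (one per `(1,1,0)`-line by
  Part I's `eq_of_mem_boundary`) inject by `v ↦ (v₂, (v₀ − v₁ + 3n − |v₂|)/2)` into two lattice
  trapezoids with `∑_{u ≤ 2n} (n+1+u) + ∑_{u < 2n} (n+1+u) = 8n² + 5n + 1` cells (`card_hexagon`) —
  the hexagonal `⟨110⟩` shadow of `TO_n`;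
* `twelve_card_sub_sum_shiftCount_le_poly`: hence twice the lattice deficiency
  `12·|TO_n| − ∑_δ shiftCount TO_n δ ≤ 12·(8n² + 5n + 1) = 2·(48n² + 30n + 6)`;
* `stub_cluster`: the REGISTERED STUB (by name and signature) of the skeleton
  `wulffUpperBound_proof` — for every `n ≥ 1` a one-parity-class piece with `≥ 16 n³` points and
  twice-deficiency `≤ 2·(48n² + 30n + 6)`.
Nothing is claimed about ground states; rung F-C1 is not moved by this file alone (the crux closes
with the peeling lemma `stub_peel` and the already-checked ε-assembly).
-/

noncomputable section

open scoped BigOperators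
open Finset

namespace Summit.Ventures.Crystal3D.Theorems

open Summit.Ventures.Crystal3D

/-! ## Part II: the hexagon count of the `(1,1,0)`-boundary -/

/-- `2 · ∑_{u < m} (a + u) + m = m (2a + m)` (an arithmetic progression, without subtraction). -/
theorem two_mul_sum_range_add (a m : ℕ) :
    2 * ∑ u ∈ range m, (a + u) + m = m * (2 * a + m) := by
  induction m with
  | zero => simp
  | succ j ih =>
    rw [sum_range_succ]
    linarith [ih]

/-- The hexagon: the two trapezoids `{(u, j) : u ≤ 2k+2, j ≤ k+1+u}` and
`{(u, j) : u ≤ 2k+1, j ≤ k+1+u}` have `8n² + 5n + 1` cells in total (`n = k+1`). -/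
theorem card_hexagon (k : ℕ) :
    ((range (2 * k + 3)).sigma fun u => range (k + 2 + u)).card +
        ((range (2 * k + 2)).sigma fun u => range (k + 2 + u)).card =
      8 * (k + 1) ^ 2 + 5 * (k + 1) + 1 := by
  rw [card_sigma, card_sigma]
  simp only [card_range]
  have h1 := two_mul_sum_range_add (k + 2) (2 * k + 3)
  have h2 := two_mul_sum_range_add (k + 2) (2 * k + 2)
  nlinarith [h1, h2]

section TO2

variable {k : ℕ} {T : Finset (Fin 3 → ℤ)}
  (hT : T = (fccOctahedronInt (3 * k + 3)).filter fun v =>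
    |v 0| ≤ 2 * (k : ℤ) + 2 ∧ |v 1| ≤ 2 * (k : ℤ) + 2 ∧ |v 2| ≤ 2 * (k : ℤ) + 2)
include hT

/-- The boundary points with `v₂ ≤ 0` inject, by `v ↦ (v₂ + 2n, (v₀ − v₁ + 3n + v₂)/2)`, into the
first trapezoid. -/
theorem card_boundary_nonpos_le :
    ((T.filter fun a => ¬ (a + ![1, 1, 0] ∈ T)).filter fun v => v 2 ≤ 0).card ≤
      ((range (2 * k + 3)).sigma fun u => range (k + 2 + u)).card := by
  refine card_le_card_of_injOn
    (fun v => (⟨(v 2 + (2 * k + 2)).toNat, ((v 0 - v 1 + (3 * k + 3) + v 2) / 2).toNat⟩ :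
      Σ _ : ℕ, ℕ)) ?_ ?_
  · intro v hv
    obtain ⟨hvb, hv2⟩ := mem_filter.1 (mem_coe.1 hv)
    have hvT := (mem_filter.1 hvb).1
    obtain ⟨⟨h1, hpar⟩, hb0, hb1, hb2⟩ := (mem_truncatedOctahedron_iff hT).1 hvT
    have a0 := le_abs_self (v 0)
    have b0 := neg_abs_le (v 0)
    have a1 := le_abs_self (v 1)
    have b1 := neg_abs_le (v 1)
    have a2 := le_abs_self (v 2)
    have b2 := neg_abs_le (v 2)
    rw [mem_coe, mem_sigma, mem_range, mem_range]
    dsimp only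
    constructor <;> omega
  · intro v hv w hw h
    obtain ⟨hvb, hv2⟩ := mem_filter.1 (mem_coe.1 hv)
    obtain ⟨hwb, hw2⟩ := mem_filter.1 (mem_coe.1 hw)
    obtain ⟨⟨hv1, hvpar⟩, hvb0, hvb1, hvb2⟩ := (mem_truncatedOctahedron_iff hT).1 (mem_filter.1 hvb).1
    obtain ⟨⟨hw1, hwpar⟩, hwb0, hwb1, hwb2⟩ := (mem_truncatedOctahedron_iff hT).1 (mem_filter.1 hwb).1
    have hu := (Sigma.mk.inj_iff.1 h).1
    have hj := eq_of_heq (Sigma.mk.inj_iff.1 h).2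
    have a0 := le_abs_self (v 0)
    have b0 := neg_abs_le (v 0)
    have a1 := le_abs_self (v 1)
    have b1 := neg_abs_le (v 1)
    have a2 := le_abs_self (v 2)
    have b2 := neg_abs_le (v 2)
    have c0 := le_abs_self (w 0)
    have d0 := neg_abs_le (w 0)
    have c1 := le_abs_self (w 1)
    have d1 := neg_abs_le (w 1)
    have c2 := le_abs_self (w 2)
    have d2 := neg_abs_le (w 2)
    exact eq_of_mem_boundary hT hvb hwb (by omega) (by omega)

/-- The boundary points with `v₂ ≥ 1` inject, by `v ↦ (2n − v₂, (v₀ − v₁ + 3n − v₂)/2)`, into the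
second trapezoid. -/
theorem card_boundary_pos_le :
    ((T.filter fun a => ¬ (a + ![1, 1, 0] ∈ T)).filter fun v => ¬ v 2 ≤ 0).card ≤
      ((range (2 * k + 2)).sigma fun u => range (k + 2 + u)).card := by
  refine card_le_card_of_injOn
    (fun v => (⟨((2 * k + 2) - v 2).toNat, ((v 0 - v 1 + (3 * k + 3) - v 2) / 2).toNat⟩ :
      Σ _ : ℕ, ℕ)) ?_ ?_
  · intro v hv
    obtain ⟨hvb, hv2⟩ := mem_filter.1 (mem_coe.1 hv)
    have hvT := (mem_filter.1 hvb).1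
    obtain ⟨⟨h1, hpar⟩, hb0, hb1, hb2⟩ := (mem_truncatedOctahedron_iff hT).1 hvT
    have a0 := le_abs_self (v 0)
    have b0 := neg_abs_le (v 0)
    have a1 := le_abs_self (v 1)
    have b1 := neg_abs_le (v 1)
    have a2 := le_abs_self (v 2)
    have b2 := neg_abs_le (v 2)
    rw [mem_coe, mem_sigma, mem_range, mem_range]
    dsimp only
    constructor <;> omega
  · intro v hv w hw h
    obtain ⟨hvb, hv2⟩ := mem_filter.1 (mem_coe.1 hv)
    obtain ⟨hwb, hw2⟩ := mem_filter.1 (mem_coe.1 hw)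
    obtain ⟨⟨hv1, hvpar⟩, hvb0, hvb1, hvb2⟩ := (mem_truncatedOctahedron_iff hT).1 (mem_filter.1 hvb).1
    obtain ⟨⟨hw1, hwpar⟩, hwb0, hwb1, hwb2⟩ := (mem_truncatedOctahedron_iff hT).1 (mem_filter.1 hwb).1
    have hu := (Sigma.mk.inj_iff.1 h).1
    have hj := eq_of_heq (Sigma.mk.inj_iff.1 h).2
    have a0 := le_abs_self (v 0)
    have b0 := neg_abs_le (v 0)
    have a1 := le_abs_self (v 1)
    have b1 := neg_abs_le (v 1)
    have a2 := le_abs_self (v 2)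
    have b2 := neg_abs_le (v 2)
    have c0 := le_abs_self (w 0)
    have d0 := neg_abs_le (w 0)
    have c1 := le_abs_self (w 1)
    have d1 := neg_abs_le (w 1)
    have c2 := le_abs_self (w 2)
    have d2 := neg_abs_le (w 2)
    exact eq_of_mem_boundary hT hvb hwb (by omega) (by omega)

/-- **The `(1,1,0)`-boundary of `TO_n` has at most `8n² + 5n + 1` points.** -/
theorem card_boundary_le :
    (T.filter fun a => ¬ (a + ![1, 1, 0] ∈ T)).card ≤ 8 * (k + 1) ^ 2 + 5 * (k + 1) + 1 := by
  rw [← card_filter_add_card_filter_not (s := T.filter fun a => ¬ (a + ![1, 1, 0] ∈ T))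
    (fun v : Fin 3 → ℤ => v 2 ≤ 0), ← card_hexagon k]
  exact Nat.add_le_add (card_boundary_nonpos_le hT) (card_boundary_pos_le hT)

/-- **Twice the lattice deficiency of `TO_n` is at most `2·(48n² + 30n + 6)`** (`n = k + 1`). -/
theorem twelve_card_sub_sum_shiftCount_le_poly :
    12 * (T.card : ℤ) - ∑ δ ∈ d3Offsets, (shiftCount T δ : ℤ) ≤
      2 * (48 * ((k : ℤ) + 1) ^ 2 + 30 * ((k : ℤ) + 1) + 6) := by
  have h1 := twelve_card_sub_sum_shiftCount_le hT
  have h2 := card_boundary_le hT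
  have h2' : (((T.filter fun a => ¬ (a + ![1, 1, 0] ∈ T)).card : ℕ) : ℤ) ≤
      ((8 * (k + 1) ^ 2 + 5 * (k + 1) + 1 : ℕ) : ℤ) := by exact_mod_cast h2
  push_cast at h2'
  nlinarith [h1, h2']

end TO2

/-! ## The registered stub -/

/-- **STUB `stub_cluster` of the skeleton `wulffUpperBound_proof`** (crux `WulffUpperBound`,
stmt-Ventures-19147, line `WulffPeel`): for every `n ≥ 1` there is a finite set of integer vectors in
one parity class of the coordinate sum (a `D₃` piece) with at least `16 n³` points and twice the
lattice deficiency `12·|S| − ∑_δ #{v ∈ S : v + δ ∈ S} ≤ 2·(48 n² + 30 n + 6)` — the truncated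
octahedron `TO_n = {Σ vᵢ ≡ n (2), |vᵢ| ≤ 2n, Σ|vᵢ| ≤ 3n}` (`16n³ + 15n² + 6n + 1` points, deficiency
exactly `48n² + 30n + 6`). -/
theorem stub_cluster :
    ∀ n : ℕ, 1 ≤ n → ∃ S : Finset (Fin 3 → ℤ),
      (∀ v ∈ S, ∀ w ∈ S, (2 : ℤ) ∣ v 0 + v 1 + v 2 - (w 0 + w 1 + w 2)) ∧
      16 * n ^ 3 ≤ S.card ∧
      12 * (S.card : ℤ) - ∑ δ ∈ d3Offsets, (shiftCount S δ : ℤ) ≤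
        2 * (48 * (n : ℤ) ^ 2 + 30 * n + 6) := by
  intro n hn
  obtain ⟨k, rfl⟩ : ∃ k, n = k + 1 := ⟨n - 1, by omega⟩
  refine ⟨(fccOctahedronInt (3 * k + 3)).filter fun v =>
      |v 0| ≤ 2 * (k : ℤ) + 2 ∧ |v 1| ≤ 2 * (k : ℤ) + 2 ∧ |v 2| ≤ 2 * (k : ℤ) + 2, ?_, ?_, ?_⟩
  · intro v hv w hw
    exact fccOctahedronInt_parity _ v (mem_filter.1 hv).1 w (mem_filter.1 hw).1
  · exact sixteen_mul_cube_le_card_truncatedOctahedron k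
  · have h := twelve_card_sub_sum_shiftCount_le_poly (k := k) rfl
    push_cast
    exact h

end Summit.Ventures.Crystal3D.Theorems

end
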